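import Literature.AlgebraicGeometry.Motives.HodgeLieTimesCMCurve
import HarnessLib

/-!
# The Weil PRODUCT brick at the Hodge-structure level: `𝔥(H₁ ⊕ H₂)_ℂ ⊇ 𝔰𝔲_K(V)_ℂ ∩ (blocks)` for a weight-one summand `H₁` with an imaginary quadratic structure `φ₁` and a CM curve `H₂` (Goursat along `ℂ Θ_H ⊕ ι₁ [𝔲₁, 𝔲₁] π₁`)

Family `hodge`, layer `Literature/AlgebraicGeometry/Motives`, namespace `Literature.AlgebraicGeometry.Motives.HodgeStructure`,
sub-namespace `WeilProductCM`. THEOREMS ONLY (no definition, no named fact, no instance, no `sorry`). Written for the cell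
`pub-hodgeav-hg6` (req-37 (A) Q2b, TABLE X Weil PRODUCT rows 17 / 19 / 20 / 22: `A ≅ Y × E`, `E` a CM elliptic curve with
`K = ℚ(√−d) = End⁰(E)`, `K ⊆ End⁰(Y)`, `(A, K)` of Weil type; brick K1 v1 of the lead's T-line 2026-08-29). HONEST FRAMING of that
cell: HC / HC_AV (stmt-1333) / HC_CM (stmt-3052) / H2 are NOT proved anywhere in this file; this is unconditional linear algebra of
polarized weight-one `ℚ`-Hodge structures and discharges no hypothesis of the census by itself.

SETTING (the interface of `Motives/HodgeLieTimesCMCurve`): `H = H₁ ⊕ H₂` presented by Hodge morphisms `ι₁ : H₁ → H`, `π₁ : H → H₁`,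
`ι₂ : H₂ → H`, `π₂ : H → H₂` with `π_i ι_i = 1`, `ι₁π₁ + ι₂π₂ = 1`; weight `n = 1`; `ψ` a polarization of `H` (ANY polarization — no
compatibility with the splitting is assumed: the restrictions `ψ ∘ (ι_i × ι_i)` are polarizations of `H_i`, §1); Hodge endomorphisms
`φ₁` of `H₁` and `φ₂` of `H₂` with `φ_i² = −d`, `d > 0`, glued to a Hodge endomorphism `Φ` of `H` (`Φ ι_i = ι_i φ_i`: the diagonal
action of `K`); `dim V₂ = 2` (`H₂` = the `H¹` of a CM elliptic curve: `𝔥(H₂)_ℂ`-type operators are multiples of `φ₂,ℂ`,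
`RankTwoCM.exists_eq_smul_of_commute_of_skew`); `μ² = −d`, `W_K = ker(Φ_ℂ − μ)`; the BALANCE (Weil type) hypotheses
`dim(W_{±μ} ∩ V^{1,0}) = dim(W_{±μ} ∩ V^{0,1})`.

INPUTS ON `H₁`, displayed as hypotheses and quantified over ALL polarizations `ψ₁` of `H₁` (so that the tree's theorems instantiate
them verbatim): `hLie₁` — for every bracket-closed rational `𝔤₁ ⊆ End_ℚ(V₁)` commuting with `End_Hdg(H₁)`, `ψ₁`-skew, whose complex
span contains the Hodge operator `Θ₁`, every `φ₁,ℂ`-commuting `ψ₁,ℂ`-skew operator lies in `spanC 𝔤₁` (the conclusion shape of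
`UnitaryTheta.mem_spanC_of_commute_of_skew` (m,1), `UnitaryThetaTwoThree.mem_spanC_of_commute_of_skew` (2,3), …: «`Lie Hg(Y) ⊗ ℂ =
𝔲_K(V₁)_ℂ`, in the strong `Θ`-hull form»); `hSL₁` — every `φ₁,ℂ`-commuting `ψ₁,ℂ`-skew `T` with `tr(φ₁,ℂ T) = 0` is a complex
combination of commutators of such operators («`𝔰𝔲_K(V₁)_ℂ = [𝔲_K(V₁)_ℂ, 𝔲_K(V₁)_ℂ]`», i.e. `𝔰𝔩(W₁) = [𝔤𝔩(W₁), 𝔤𝔩(W₁)]`; a separate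
brick). The `∀ 𝔤₁` form of `hLie₁` is needed because the corner algebra `π₁ 𝔥(H) ι₁ ⊆ 𝔥(H₁)` may be smaller than `𝔥(H₁)`.

* §0 `WeilProductCM.trace_eq_zero_of_skew` (a skew operator for a non-degenerate form is traceless),
  `WeilProductCM.two_mul_mul_trace_restrict_eq` (`2μ·tr(Z|_{W_μ}) = μ·tr Z + tr(φ_ℂ Z)` for `Z` commuting with `φ_ℂ`, `φ² = −d`).
* §1 `WeilProductCM.exists_polarization_comp` — `ψ ∘ (ι × ι)` is a polarization of a retract summand (Voisin I, Lemma 7.26).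
* §2 **`WeilProductCM.mem_hodgeLieC_of_commute_of_skew_of_trace`** — THE BRICK: every `Y ∈ End(V_ℂ)` commuting with `(ι₁π₁)_ℂ`
  (block diagonal) and with `Φ_ℂ` (`K`-linear), `ψ_ℂ`-skew, with `tr(Y | W_K) = 0`, lies in `𝔥(H)_ℂ = hodgeLieC H`. PROOF (Goursat for
  `𝔥(H) ⊆ 𝔥(H₁) × 𝔥(H₂)` with `𝔥(H₂) = ℚφ₂` a torus, Moonen–Zarhin (3.6)–(3.8)): the `V₂`-blocks of `Y` and of the Hodge operator
  `Θ_H ∈ 𝔥(H)_ℂ` (Deligne) are `z φ₂,ℂ`, `c φ₂,ℂ` with `c ≠ 0`; `Z = Y − (z/c) Θ_H` has zero `V₂`-block, so `Z = ι₁ T π₁` with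
  `T = π₁ Z ι₁` commuting with `φ₁,ℂ`, skew for `ψ ∘ (ι₁ × ι₁)`, and `tr(φ₁,ℂ T) = tr(Φ_ℂ Z) = tr(Φ_ℂ Y) − (z/c) tr(Φ_ℂ Θ_H) = 0`
  (`tr(Φ_ℂ Y) = 2μ tr(Y|W_K) − μ tr Y = 0`; `tr(Θ_H Φ_ℂ) = 0` is the balance, `trace_theta_mul_baseChange_eq_of_sq_eq_neg`); by `hSL₁`,
  `T` is a combination of brackets `[A, B]` of `φ₁,ℂ`-commuting skew operators, which by `hLie₁` (applied to the corner algebra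
  `𝔤₁ = π₁ 𝔥(H) ι₁`, admissible with `Θ₁ = π₁ Θ_H ι₁ ∈ spanC 𝔤₁`) lie in `spanC 𝔤₁`; and `ι₁ [π₁Xι₁, π₁X′ι₁] π₁ = [X, X′] ∈ 𝔥(H)` for
  `X, X′ ∈ 𝔥(H)` because brackets of `𝔥(H)` have zero `V₂`-block (`restrict₂_commutator_eq_zero_of_cmCurve`). Hence
  `Y = (z/c) Θ_H + ι₁ T π₁ ∈ 𝔥(H)_ℂ`. NO non-resonance hypothesis (contrast `HodgeLieTimesCMCurve` §4) and no comparison of `ψ` with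
  the splitting is used.

What this file does NOT do: the AV-level reading (`A ≅ Y × E`, `H¹(A) = H¹(Y) ⊕ H¹(E)`), the inputs `hLie₁` / `hSL₁` for any row, the
Lie-to-group passage, any Hodge-conjecture statement.

## References
* [MoonenZarhin1999LowDim] B. Moonen, Yu. Zarhin, Hodge classes and Tate classes on simple abelian fourfolds / low dimension,
  §2 (2.1), (2.3), §3 Lemma (3.6), Prop. (3.8), §5.
* [MoonenZarhin1998WeilClasses] B. Moonen, Yu. Zarhin, Weil classes on abelian varieties, J. reine angew. Math. 496 (1998), §4 Remark (1).
* [Deligne1982HodgeCycles] P. Deligne, Hodge cycles on abelian varieties, LNM 900 (1982), I §3 Prop. 3.4, 3.6; §4 (p. 30).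
* [Ribet1983] K. A. Ribet, Hodge classes on certain types of abelian varieties, Amer. J. Math. 105 (1983), Thm. 3.
* [VoisinHodgeI2002] C. Voisin, Hodge Theory and Complex Algebraic Geometry I, Lemma 7.26.
-/

noncomputable section

open scoped TensorProduct

namespace Literature.AlgebraicGeometry.Motives

namespace HodgeStructure

universe u

/-! ## §0 Two trace lemmas -/

section Traces

variable {V : Type u} [AddCommGroup V] [Module ℚ V]

/-- A `B`-skew operator `Y` of a finite-dimensional space with `B` non-degenerate is traceless: `B♭ ∘ Y = -Yᵗ ∘ B♭`, so `Y` is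
conjugate to `-Yᵗ` and `tr Y = -tr Y` (the classical algebras `𝔰𝔬(B)`, `𝔰𝔭(B)` lie in `𝔰𝔩`). [cite: Humphreys1972, §1.2] -/
theorem WeilProductCM.trace_eq_zero_of_skew {M : Type*} [AddCommGroup M] [Module ℂ M]
    [FiniteDimensional ℂ M] {B : LinearMap.BilinForm ℂ M} (hB : B.Nondegenerate) {Y : Module.End ℂ M}
    (hY : ∀ x y, B (Y x) y + B x (Y y) = 0) : LinearMap.trace ℂ M Y = 0 := by
  -- adapted from the private `UnitaryThetaTwoTwo.trace_eq_zero_of_skew` of `Motives/HodgeThetaSubalgebraUnitaryTwoTwo`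
  have hconj : Y = (B.toDual hB).symm.conj (-Y.dualMap) := by
    refine LinearMap.ext fun x => (B.toDual hB).injective (LinearMap.ext fun z => ?_)
    simp only [LinearEquiv.conj_apply, LinearEquiv.symm_symm, LinearMap.comp_apply, LinearEquiv.coe_coe,
      LinearEquiv.apply_symm_apply, LinearMap.neg_apply, LinearMap.dualMap_apply,
      LinearMap.BilinForm.toDual_def]
    linear_combination hY x z
  have h1 : LinearMap.trace ℂ M Y = -LinearMap.trace ℂ M Y := by
    conv_lhs => rw [hconj]
    rw [LinearMap.trace_conj', map_neg]
    exact congrArg Neg.neg (LinearMap.trace_transpose' (R := ℂ) Y)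
  linear_combination h1 / 2

/-- **Traces on `W = ker(φ_ℂ − μ)`.** For `φ² = −d` (`d > 0`), `μ² = −d` and `Z` commuting with `φ_ℂ`:
`2μ · tr(Z|_W) = μ · tr Z + tr(φ_ℂ Z)` (`V_ℂ = W ⊕ W′`, `W′ = ker(φ_ℂ + μ)`, `tr = tr_W + tr_{W′}`, `tr(φ_ℂ Z) = μ tr_W − μ tr_{W′}`).
[cite: MoonenZarhin1999LowDim, §2 (2.3)] -/
theorem WeilProductCM.two_mul_mul_trace_restrict_eq [Module.Finite ℚ V] {φ : Module.End ℚ V} {d : ℚ} (hd : 0 < d)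
    (hφ2 : φ * φ = -(d • 1)) {μ : ℂ} (hμ : μ ^ 2 = -(d : ℂ)) {Z : Module.End ℂ (ℂ ⊗[ℚ] V)}
    (hZφ : Z * φ.baseChange ℂ = φ.baseChange ℂ * Z)
    (hZW : ∀ w ∈ Module.End.eigenspace (φ.baseChange ℂ) μ, Z w ∈ Module.End.eigenspace (φ.baseChange ℂ) μ) :
    2 * μ * LinearMap.trace ℂ ↥(Module.End.eigenspace (φ.baseChange ℂ) μ) (Z.restrict hZW) =
      μ * LinearMap.trace ℂ (ℂ ⊗[ℚ] V) Z + LinearMap.trace ℂ (ℂ ⊗[ℚ] V) (φ.baseChange ℂ * Z) := by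
  -- adapted from the private `UnitaryThetaTwoTwo.trace_restrict_eq_zero` of `Motives/HodgeThetaSubalgebraUnitaryTwoTwo`
  classical
  obtain ⟨hμ0, -⟩ := UnitaryTheta.conj_eq_neg_of_sq hd hμ
  set W := Module.End.eigenspace (φ.baseChange ℂ) μ with hWdef
  set W' := Module.End.eigenspace (φ.baseChange ℂ) (-μ) with hW'def
  have hZW' : ∀ w ∈ W', Z w ∈ W' := fun w hw => UnitaryTheta.apply_mem_eigenspace_of_commute hZφ hw
  have hφZφ : (φ.baseChange ℂ * Z) * φ.baseChange ℂ = φ.baseChange ℂ * (φ.baseChange ℂ * Z) := by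
    rw [mul_assoc, hZφ]
  have hφZW : ∀ w ∈ W, (φ.baseChange ℂ * Z) w ∈ W := fun w hw =>
    UnitaryTheta.apply_mem_eigenspace_of_commute hφZφ hw
  have hφZW' : ∀ w ∈ W', (φ.baseChange ℂ * Z) w ∈ W' := fun w hw =>
    UnitaryTheta.apply_mem_eigenspace_of_commute hφZφ hw
  have hc : IsCompl W W' := by
    refine ⟨disjoint_iff.2 (eq_bot_iff.2 fun x hx => ?_), codisjoint_iff.2 (eq_top_iff.2 fun v _ => ?_)⟩
    · rw [Submodule.mem_bot]
      exact UnitaryTheta.eq_zero_of_mem_eigenspace_of_mem_eigenspace_neg hμ0 (Submodule.mem_inf.1 hx).1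
        (Submodule.mem_inf.1 hx).2
    · obtain ⟨w, hw, w', hw', rfl⟩ := UnitaryTheta.exists_eigen_add_eigen hφ2 hμ hμ0 v
      exact Submodule.add_mem_sup hw hw'
  let N' : Bool → Submodule ℂ (ℂ ⊗[ℚ] V) := fun b => cond b W W'
  have hint : DirectSum.IsInternal N' :=
    (DirectSum.isInternal_submodule_iff_isCompl N' (i := true) (j := false) (by decide)
      (Set.eq_univ_of_forall fun b => by cases b <;> simp).symm).2 hc
  have hmaps : ∀ b, Set.MapsTo Z (N' b) (N' b) := fun b =>
    match b with
    | true => hZW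
    | false => hZW'
  have hmapsφ : ∀ b, Set.MapsTo (φ.baseChange ℂ * Z) (N' b) (N' b) := fun b =>
    match b with
    | true => hφZW
    | false => hφZW'
  have hs1 := LinearMap.trace_eq_sum_trace_restrict hint hmaps
  have hs2 := LinearMap.trace_eq_sum_trace_restrict hint hmapsφ
  rw [Fintype.sum_bool] at hs1 hs2
  have hs1' : LinearMap.trace ℂ (ℂ ⊗[ℚ] V) Z =
      LinearMap.trace ℂ W (Z.restrict hZW) + LinearMap.trace ℂ W' (Z.restrict hZW') := hs1
  have hs2' : LinearMap.trace ℂ (ℂ ⊗[ℚ] V) (φ.baseChange ℂ * Z) =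
      LinearMap.trace ℂ W ((φ.baseChange ℂ * Z).restrict hφZW) +
        LinearMap.trace ℂ W' ((φ.baseChange ℂ * Z).restrict hφZW') := hs2
  have hr1 : (φ.baseChange ℂ * Z).restrict hφZW = μ • Z.restrict hZW :=
    LinearMap.ext fun w => Subtype.ext (by
      simp only [LinearMap.coe_restrict_apply, LinearMap.smul_apply, Submodule.coe_smul, Module.End.mul_apply]
      exact Module.End.mem_eigenspace_iff.1 (hZW w w.2))
  have hr2 : (φ.baseChange ℂ * Z).restrict hφZW' = (-μ) • Z.restrict hZW' :=
    LinearMap.ext fun w => Subtype.ext (by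
      simp only [LinearMap.coe_restrict_apply, LinearMap.smul_apply, Submodule.coe_smul, Module.End.mul_apply]
      exact Module.End.mem_eigenspace_iff.1 (hZW' w w.2))
  rw [hr1, hr2, map_smul, map_smul, smul_eq_mul, smul_eq_mul] at hs2'
  linear_combination -μ * hs1' - hs2'

end Traces

/-! ## §1 The setting; restricted polarizations -/

variable {V₁ : Type u} [AddCommGroup V₁] [Module ℚ V₁] [Module.Finite ℚ V₁]
  {V₂ : Type u} [AddCommGroup V₂] [Module ℚ V₂] [Module.Finite ℚ V₂]
  {V : Type u} [AddCommGroup V] [Module ℚ V] [Module.Finite ℚ V] [HodgeTensorFacts.{u, u}] {n : ℤ}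
  {H₁ : HodgeStructure V₁ n} {H₂ : HodgeStructure V₂ n} {H : HodgeStructure V n}

omit [Module.Finite ℚ V₁] [Module.Finite ℚ V] [HodgeTensorFacts.{u, u}] in
/-- **The restriction `ψ ∘ (ι × ι)` of a polarization along a retract summand `ι : H₁ → H` (`π ι = 1`) is a polarization of
`H₁`** (the Hodge–Riemann relations are inherited: `ι_ℂ` preserves `F^p` and `V^{p,q}`, commutes with conjugation, and is
injective). [cite: VoisinHodgeI2002, Lemma 7.26] -/
theorem WeilProductCM.exists_polarization_comp (ι : Hom H₁ H) (π : Hom H H₁)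
    (hπι : ∀ v, π.toLinearMap (ι.toLinearMap v) = v) (ψ : H.Polarization) :
    ∃ ψ₁ : H₁.Polarization, ψ₁.form = ψ.form.compl₁₂ ι.toLinearMap ι.toLinearMap := by
  have hπι' : π.toLinearMap ∘ₗ ι.toLinearMap = LinearMap.id := LinearMap.ext hπι
  refine ⟨{ form := ψ.form.compl₁₂ ι.toLinearMap ι.toLinearMap
            flip_form := ?_
            form_apply_eq_zero := ?_
            pos := ?_ }, rfl⟩
  · refine LinearMap.ext fun x => LinearMap.ext fun y => ?_
    have h := LinearMap.congr_fun₂ ψ.flip_form (ι.toLinearMap x) (ι.toLinearMap y)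
    simp only [LinearMap.BilinForm.flip_apply, LinearMap.smul_apply, LinearMap.compl₁₂_apply] at h ⊢
    exact h
  · intro p x hx y hy
    rw [baseChange_compl₁₂]
    exact ψ.form_apply_eq_zero p _ (ι.map_F_le p ⟨x, hx, rfl⟩) _ (ι.map_F_le _ ⟨y, hy, rfl⟩)
  · intro p q hpq x hx hx0
    have hx0' : ι.toLinearMap.baseChange ℂ x ≠ 0 := fun h => hx0 (by
      rw [← proj_incl_baseChange hπι' x, h, map_zero])
    obtain ⟨r, hr, hQ⟩ := ψ.pos p q hpq _ (ι.map_piece_le p q ⟨x, hx, rfl⟩) hx0'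
    refine ⟨r, hr, ?_⟩
    rw [baseChange_compl₁₂, ← conj_baseChange]
    exact hQ

/-! ## §2 The brick -/

/-- **`𝔥(H₁ ⊕ H₂)_ℂ` contains every block-diagonal `K`-linear `ψ_ℂ`-skew operator with trace `0` on `W_K`** (`H₂` a CM curve,
`(H, Φ)` balanced = of Weil type, `H₁` with the displayed Lie inputs `hLie₁`, `hSL₁`; see the module docstring for the setting and the
proof: Goursat along `ℂ Θ_H ⊕ ι₁ [𝔲₁, 𝔲₁] π₁ ⊆ 𝔥(H)_ℂ`, the torus `𝔥(H₂) = ℚ φ₂` contributing only through `Θ_H`). This is the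
Hodge-structure-level form of «`Hg(Y × E) ⊇ SU_K(H¹(Y) ⊕ H¹(E)) ∩ (U_K(H¹ Y) × U_K(H¹ E))`» for a Weil-type product with a CM
elliptic curve; the hypotheses `hYe`, `hYΦ` say that `Y` commutes with the Hodge endomorphisms `ι₁π₁` and `Φ`, `hYtr` is the
`W_K`-trace condition of the cell's Lie-to-group sockets. Nothing about algebraic cycles is proved.
[cite: MoonenZarhin1999LowDim, §3 Lemma (3.6) and Prop. (3.8); §5] [cite: MoonenZarhin1998WeilClasses, §4 Remark (1)]
[cite: Deligne1982HodgeCycles, I §3 Prop. 3.4 and 3.6; §4 (p. 30)] [cite: Ribet1983, Thm. 3] -/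
theorem WeilProductCM.mem_hodgeLieC_of_commute_of_skew_of_trace
    (ι₁ : Hom H₁ H) (π₁ : Hom H H₁) (ι₂ : Hom H₂ H) (π₂ : Hom H H₂)
    (hπι₁ : ∀ v, π₁.toLinearMap (ι₁.toLinearMap v) = v) (hπι₂ : ∀ v, π₂.toLinearMap (ι₂.toLinearMap v) = v)
    (hsum : ∀ v, ι₁.toLinearMap (π₁.toLinearMap v) + ι₂.toLinearMap (π₂.toLinearMap v) = v)
    (hn : n = 1) (heff : H.IsEffective) (heff₂ : H₂.IsEffective) (ψ : H.Polarization)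
    {φ₁ : Module.End ℚ V₁} (hφ₁E : φ₁ ∈ H₁.endAlg) {φ₂ : Module.End ℚ V₂} (hφ₂E : φ₂ ∈ H₂.endAlg)
    {d : ℚ} (hd : 0 < d) (hφ₁ : φ₁ * φ₁ = -(d • 1)) (hφ₂ : φ₂ * φ₂ = -(d • 1)) (hV₂ : Module.finrank ℚ V₂ = 2)
    {μ : ℂ} (hμ : μ ^ 2 = -(d : ℂ))
    {Φ : Module.End ℚ V} (hΦE : Φ ∈ H.endAlg) (hΦ₁ : Φ ∘ₗ ι₁.toLinearMap = ι₁.toLinearMap ∘ₗ φ₁)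
    (hΦ₂ : Φ ∘ₗ ι₂.toLinearMap = ι₂.toLinearMap ∘ₗ φ₂)
    (hbal : Module.finrank ℂ ↥(Module.End.eigenspace (Φ.baseChange ℂ) μ ⊓ H.piece 1 0) =
      Module.finrank ℂ ↥(Module.End.eigenspace (Φ.baseChange ℂ) μ ⊓ H.piece 0 1))
    (hbal' : Module.finrank ℂ ↥(Module.End.eigenspace (Φ.baseChange ℂ) (-μ) ⊓ H.piece 1 0) =
      Module.finrank ℂ ↥(Module.End.eigenspace (Φ.baseChange ℂ) (-μ) ⊓ H.piece 0 1))
    {Θ₁ : Module.End ℂ (ℂ ⊗[ℚ] V₁)} (hΘ₁ : ∀ p, ∀ x ∈ H₁.piece p (n - p), Θ₁ x = ((2 * p - n : ℤ) : ℂ) • x)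
    (hLie₁ : ∀ (ψ₁ : H₁.Polarization) (𝔤₁ : Submodule ℚ (Module.End ℚ V₁)),
      (∀ X ∈ 𝔤₁, ∀ X' ∈ 𝔤₁, X * X' - X' * X ∈ 𝔤₁) → Θ₁ ∈ spanC 𝔤₁ →
      (∀ X ∈ 𝔤₁, ∀ a : H₁.endAlg, X * (a : Module.End ℚ V₁) = (a : Module.End ℚ V₁) * X) →
      (∀ X ∈ 𝔤₁, ∀ v w, ψ₁.form (X v) w + ψ₁.form v (X w) = 0) →
      ∀ T : Module.End ℂ (ℂ ⊗[ℚ] V₁), T * φ₁.baseChange ℂ = φ₁.baseChange ℂ * T →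
        (∀ x y, ψ₁.form.baseChange ℂ (T x) y + ψ₁.form.baseChange ℂ x (T y) = 0) → T ∈ spanC 𝔤₁)
    (hSL₁ : ∀ (ψ₁ : H₁.Polarization) (T : Module.End ℂ (ℂ ⊗[ℚ] V₁)),
      T * φ₁.baseChange ℂ = φ₁.baseChange ℂ * T →
      (∀ x y, ψ₁.form.baseChange ℂ (T x) y + ψ₁.form.baseChange ℂ x (T y) = 0) →
      LinearMap.trace ℂ _ (φ₁.baseChange ℂ * T) = 0 →
      T ∈ Submodule.span ℂ {D : Module.End ℂ (ℂ ⊗[ℚ] V₁) | ∃ A B : Module.End ℂ (ℂ ⊗[ℚ] V₁),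
        A * φ₁.baseChange ℂ = φ₁.baseChange ℂ * A ∧ B * φ₁.baseChange ℂ = φ₁.baseChange ℂ * B ∧
        (∀ x y, ψ₁.form.baseChange ℂ (A x) y + ψ₁.form.baseChange ℂ x (A y) = 0) ∧
        (∀ x y, ψ₁.form.baseChange ℂ (B x) y + ψ₁.form.baseChange ℂ x (B y) = 0) ∧ D = A * B - B * A})
    {Y : Module.End ℂ (ℂ ⊗[ℚ] V)}
    (hYe : Y * (ι₁.toLinearMap ∘ₗ π₁.toLinearMap).baseChange ℂ = (ι₁.toLinearMap ∘ₗ π₁.toLinearMap).baseChange ℂ * Y)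
    (hYΦ : Y * Φ.baseChange ℂ = Φ.baseChange ℂ * Y)
    (hYskew : ∀ x y, ψ.form.baseChange ℂ (Y x) y + ψ.form.baseChange ℂ x (Y y) = 0)
    (hYtr : LinearMap.trace ℂ _ (Y.restrict fun x (hx : x ∈ Module.End.eigenspace (Φ.baseChange ℂ) μ) =>
        UnitaryTheta.apply_mem_eigenspace_of_commute hYΦ hx) = 0) :
    Y ∈ H.hodgeLieC := by
  classical
  subst hn
  obtain ⟨hμ0, -⟩ := UnitaryTheta.conj_eq_neg_of_sq hd hμ
  -- §A notation and the splitting identities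
  set i₁ := ι₁.toLinearMap.baseChange ℂ with hi₁
  set p₁ := π₁.toLinearMap.baseChange ℂ with hp₁
  set i₂ := ι₂.toLinearMap.baseChange ℂ with hi₂
  set p₂ := π₂.toLinearMap.baseChange ℂ with hp₂
  set ΦC := Φ.baseChange ℂ with hΦC
  set φ₁C := φ₁.baseChange ℂ with hφ₁C
  set φ₂C := φ₂.baseChange ℂ with hφ₂C
  set ψC := ψ.form.baseChange ℂ with hψC
  set e₁ := (ι₁.toLinearMap ∘ₗ π₁.toLinearMap).baseChange ℂ with he₁
  have hπι₁' : π₁.toLinearMap ∘ₗ ι₁.toLinearMap = LinearMap.id := LinearMap.ext hπι₁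
  have hπι₂' : π₂.toLinearMap ∘ₗ ι₂.toLinearMap = LinearMap.id := LinearMap.ext hπι₂
  have h21 : π₂.toLinearMap ∘ₗ ι₁.toLinearMap = 0 := LinearMap.ext fun v => by
    have h := congrArg π₂.toLinearMap (hsum (ι₁.toLinearMap v))
    rw [map_add, hπι₁ v, hπι₂] at h
    exact add_eq_left.1 h
  have h12 : π₁.toLinearMap ∘ₗ ι₂.toLinearMap = 0 := LinearMap.ext fun v => by
    have h := congrArg π₁.toLinearMap (hsum (ι₂.toLinearMap v))
    rw [map_add, hπι₂ v, hπι₁] at h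
    exact add_eq_left.1 h
  have hsum' : ι₁.toLinearMap ∘ₗ π₁.toLinearMap + ι₂.toLinearMap ∘ₗ π₂.toLinearMap = LinearMap.id := LinearMap.ext hsum
  have hpi₁ : ∀ x, p₁ (i₁ x) = x := proj_incl_baseChange hπι₁'
  have hpi₂ : ∀ x, p₂ (i₂ x) = x := proj_incl_baseChange hπι₂'
  have hp₂i₁ : ∀ x, p₂ (i₁ x) = 0 := proj_incl_baseChange_eq_zero h21
  have hp₁i₂ : ∀ x, p₁ (i₂ x) = 0 := proj_incl_baseChange_eq_zero h12
  have hsumC : ∀ y, i₁ (p₁ y) + i₂ (p₂ y) = y := incl_proj_add_baseChange hsum'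
  have he₁' : e₁ = i₁ ∘ₗ p₁ := by rw [he₁, LinearMap.baseChange_comp]
  have he₁x : ∀ x, e₁ x = i₁ (p₁ x) := fun x => by rw [he₁', LinearMap.comp_apply]
  -- `Φ ι_i = ι_i φ_i`, `π_i Φ = φ_i π_i`, `Φ² = -d`
  have hΦi₁ : ∀ x, ΦC (i₁ x) = i₁ (φ₁C x) := fun x => by
    rw [hΦC, hi₁, ← LinearMap.comp_apply, ← LinearMap.baseChange_comp, hΦ₁, LinearMap.baseChange_comp,
      LinearMap.comp_apply]
  have hΦi₂ : ∀ x, ΦC (i₂ x) = i₂ (φ₂C x) := fun x => by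
    rw [hΦC, hi₂, ← LinearMap.comp_apply, ← LinearMap.baseChange_comp, hΦ₂, LinearMap.baseChange_comp,
      LinearMap.comp_apply]
  have hΦy : ∀ y, ΦC y = i₁ (φ₁C (p₁ y)) + i₂ (φ₂C (p₂ y)) := fun y => by
    conv_lhs => rw [← hsumC y]
    rw [map_add, hΦi₁, hΦi₂]
  have hp₁Φ : ∀ y, p₁ (ΦC y) = φ₁C (p₁ y) := fun y => by
    rw [hΦy, map_add, hpi₁, hp₁i₂, add_zero]
  have hp₂Φ : ∀ y, p₂ (ΦC y) = φ₂C (p₂ y) := fun y => by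
    rw [hΦy, map_add, hp₂i₁, hpi₂, zero_add]
  have hΦv : ∀ v, Φ v = ι₁.toLinearMap (φ₁ (π₁.toLinearMap v)) + ι₂.toLinearMap (φ₂ (π₂.toLinearMap v)) := fun v => by
    conv_lhs => rw [← hsum v]
    rw [map_add, ← LinearMap.comp_apply Φ ι₁.toLinearMap, hΦ₁, ← LinearMap.comp_apply Φ ι₂.toLinearMap, hΦ₂,
      LinearMap.comp_apply, LinearMap.comp_apply]
  have hΦ2 : Φ * Φ = -(d • 1) := by
    refine LinearMap.ext fun v => ?_
    rw [Module.End.mul_apply, hΦv (Φ v)]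
    have h1 : π₁.toLinearMap (Φ v) = φ₁ (π₁.toLinearMap v) := by
      rw [hΦv v, map_add, hπι₁, ← LinearMap.comp_apply π₁.toLinearMap ι₂.toLinearMap, h12, LinearMap.zero_apply, add_zero]
    have h2 : π₂.toLinearMap (Φ v) = φ₂ (π₂.toLinearMap v) := by
      rw [hΦv v, map_add, hπι₂, ← LinearMap.comp_apply π₂.toLinearMap ι₁.toLinearMap, h21, LinearMap.zero_apply, zero_add]
    rw [h1, h2, ← Module.End.mul_apply φ₁ φ₁, hφ₁, ← Module.End.mul_apply φ₂ φ₂, hφ₂, LinearMap.neg_apply,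
      LinearMap.neg_apply, LinearMap.neg_apply, LinearMap.smul_apply, LinearMap.smul_apply, LinearMap.smul_apply,
      Module.End.one_apply, Module.End.one_apply, Module.End.one_apply, map_neg, map_neg, map_smul, map_smul,
      ← neg_add, ← smul_add, hsum v]
  -- §B the Hodge operator `Θ_H ∈ 𝔥(H)_ℂ`, its corner `π₁ Θ_H ι₁ = Θ₁`
  obtain ⟨Θ, hΘ⟩ := exists_hodgeTheta H
  have hΘC : Θ ∈ H.hodgeLieC := H.mem_hodgeLieC_of_forall_piece hΘ
  have hΘΦ : Θ * ΦC = ΦC * Θ := commute_baseChange_of_mem_hodgeLieC H hΘC ⟨Φ, hΦE⟩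
  have he₁E : ι₁.toLinearMap ∘ₗ π₁.toLinearMap ∈ H.endAlg := Hom.toLinearMap_mem_endAlg (ι₁.comp π₁)
  have hΘe : Θ * e₁ = e₁ * Θ := commute_baseChange_of_mem_hodgeLieC H hΘC ⟨_, he₁E⟩
  have hΘskew : ∀ x y, ψC (Θ x) y + ψC x (Θ y) = 0 := fun x y => by
    rw [hψC, formBaseChange_skew_of_mem_hodgeLieC ψ hΘC, neg_add_cancel]
  have hι₁F : ∀ p, ∀ x ∈ H₁.piece p (1 - p), ι₁.toLinearMap.baseChange ℂ x ∈ H.piece p (1 - p) :=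
    fun p x hx => ι₁.map_piece_le p _ ⟨x, hx, rfl⟩
  have hΘι₁ := theta_incl_eq H H₁ hι₁F hΘ hΘ₁
  have hpΘi₁ : ∀ x, p₁ (Θ (i₁ x)) = Θ₁ x := fun x => by rw [hΘι₁, hpi₁]
  -- §C restricted polarizations
  obtain ⟨ψ₁, hψ₁⟩ := WeilProductCM.exists_polarization_comp ι₁ π₁ hπι₁ ψ
  obtain ⟨ψ₂, hψ₂⟩ := WeilProductCM.exists_polarization_comp ι₂ π₂ hπι₂ ψ
  have hψ₁C : ∀ x y, ψ₁.form.baseChange ℂ x y = ψC (i₁ x) (i₁ y) := fun x y => by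
    rw [hψ₁, baseChange_compl₁₂]
  have hψ₂C : ∀ x y, ψ₂.form.baseChange ℂ x y = ψC (i₂ x) (i₂ y) := fun x y => by
    rw [hψ₂, baseChange_compl₁₂]
  -- §D blocks of block-diagonal operators
  have hblk : ∀ Z : Module.End ℂ (ℂ ⊗[ℚ] V), Z * e₁ = e₁ * Z →
      (∀ x, i₁ (p₁ (Z (i₁ x))) = Z (i₁ x)) ∧ (∀ x, i₂ (p₂ (Z (i₂ x))) = Z (i₂ x)) := by
    intro Z hZe
    have hZe' : ∀ x, Z (e₁ x) = e₁ (Z x) := fun x => by rw [← Module.End.mul_apply, hZe, Module.End.mul_apply]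
    refine ⟨fun x => ?_, fun x => ?_⟩
    · rw [← he₁x, ← hZe', he₁x, hpi₁]
    · have h1 : i₁ (p₁ (Z (i₂ x))) = 0 := by rw [← he₁x, ← hZe', he₁x, hp₁i₂, map_zero, map_zero]
      have h2 := hsumC (Z (i₂ x))
      rwa [h1, zero_add] at h2
  -- §E the `V₂`-blocks of `Y` and `Θ_H` are multiples of `φ₂,ℂ`
  have hblk₂φ : ∀ Z : Module.End ℂ (ℂ ⊗[ℚ] V), Z * ΦC = ΦC * Z →
      (p₂ ∘ₗ Z ∘ₗ i₂) * φ₂C = φ₂C * (p₂ ∘ₗ Z ∘ₗ i₂) := fun Z hZΦ => by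
    refine LinearMap.ext fun x => ?_
    change p₂ (Z (i₂ (φ₂C x))) = φ₂C (p₂ (Z (i₂ x)))
    rw [← hΦi₂, ← Module.End.mul_apply Z ΦC, hZΦ, Module.End.mul_apply, hp₂Φ]
  have hblk₂skew : ∀ Z : Module.End ℂ (ℂ ⊗[ℚ] V), Z * e₁ = e₁ * Z → (∀ x y, ψC (Z x) y + ψC x (Z y) = 0) →
      ∀ x y, ψ₂.form.baseChange ℂ ((p₂ ∘ₗ Z ∘ₗ i₂) x) y + ψ₂.form.baseChange ℂ x ((p₂ ∘ₗ Z ∘ₗ i₂) y) = 0 := by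
    intro Z hZe hZskew x y
    rw [hψ₂C, hψ₂C]
    change ψC (i₂ (p₂ (Z (i₂ x)))) (i₂ y) + ψC (i₂ x) (i₂ (p₂ (Z (i₂ y)))) = 0
    rw [(hblk Z hZe).2, (hblk Z hZe).2]
    exact hZskew _ _
  obtain ⟨z, hz⟩ := RankTwoCM.exists_eq_smul_of_commute_of_skew H₂ rfl heff₂ hV₂ ψ₂ hφ₂E hd hφ₂ (hblk₂φ Y hYΦ)
    (hblk₂skew Y hYe hYskew)
  obtain ⟨c, hc⟩ := RankTwoCM.exists_eq_smul_of_commute_of_skew H₂ rfl heff₂ hV₂ ψ₂ hφ₂E hd hφ₂ (hblk₂φ Θ hΘΦ)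
    (hblk₂skew Θ hΘe hΘskew)
  have hc0 : c ≠ 0 := by
    obtain ⟨Θ₂, hΘ₂⟩ := exists_hodgeTheta H₂
    obtain ⟨h10, -⟩ := RankTwoTheta.finrank_pieces_eq_one H₂ rfl heff₂ hV₂ hΘ₂
    obtain ⟨x, hx⟩ := (Module.finrank_pos_iff_exists_ne_zero (R := ℂ) (M := ↥(H₂.piece 1 0))).1 (by omega)
    intro h0
    rw [h0, zero_smul] at hc
    have hι₂x : i₂ (x : ℂ ⊗[ℚ] V₂) ∈ H.piece 1 (1 - 1) := by
      rw [sub_self]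
      exact ι₂.map_piece_le 1 0 ⟨x, x.2, rfl⟩
    have hΘx : Θ (i₂ x) = i₂ x := by
      have h := hΘ 1 _ hι₂x
      norm_num at h
      exact h
    have h := LinearMap.congr_fun hc (x : ℂ ⊗[ℚ] V₂)
    rw [LinearMap.comp_apply, LinearMap.comp_apply, hΘx, hpi₂, LinearMap.zero_apply] at h
    exact hx (Subtype.ext h)
  -- §F the operator `Z = Y - (z/c) Θ_H` with zero `V₂`-block
  set lam : ℂ := z / c with hlam
  obtain ⟨Z, hZdef⟩ : ∃ Z : Module.End ℂ (ℂ ⊗[ℚ] V), Z = Y - lam • Θ := ⟨_, rfl⟩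
  have hZ₂ : p₂ ∘ₗ Z ∘ₗ i₂ = 0 := by
    have h : p₂ ∘ₗ Z ∘ₗ i₂ = p₂ ∘ₗ Y ∘ₗ i₂ - lam • (p₂ ∘ₗ Θ ∘ₗ i₂) := by
      rw [hZdef, LinearMap.sub_comp, LinearMap.comp_sub, LinearMap.smul_comp, LinearMap.comp_smul]
    rw [h, hz, hc, smul_smul, hlam, div_mul_cancel₀ z hc0, sub_self]
  have hZe : Z * e₁ = e₁ * Z := by rw [hZdef, sub_mul, mul_sub, smul_mul_assoc, mul_smul_comm, hYe, hΘe]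
  have hZΦ : Z * ΦC = ΦC * Z := by rw [hZdef, sub_mul, mul_sub, smul_mul_assoc, mul_smul_comm, hYΦ, hΘΦ]
  have hZskew : ∀ x y, ψC (Z x) y + ψC x (Z y) = 0 := fun x y => by
    rw [hZdef, LinearMap.sub_apply, LinearMap.smul_apply, LinearMap.sub_apply, LinearMap.smul_apply, map_sub,
      map_smul, LinearMap.sub_apply, LinearMap.smul_apply, map_sub, map_smul, smul_eq_mul, smul_eq_mul]
    linear_combination hYskew x y - lam * hΘskew x y
  obtain ⟨hZi₁, hZi₂⟩ := hblk Z hZe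
  -- the corner `T = π₁ Z ι₁` and `Z = ι₁ T π₁`
  obtain ⟨T, hTdef⟩ : ∃ T : Module.End ℂ (ℂ ⊗[ℚ] V₁), T = p₁ ∘ₗ Z ∘ₗ i₁ := ⟨_, rfl⟩
  have hTx : ∀ x, T x = p₁ (Z (i₁ x)) := fun x => by rw [hTdef, LinearMap.comp_apply, LinearMap.comp_apply]
  have hZT : Z = i₁ ∘ₗ T ∘ₗ p₁ := by
    refine LinearMap.ext fun y => ?_
    have h0 : p₂ (Z (i₂ (p₂ y))) = 0 := by
      have h := LinearMap.congr_fun hZ₂ (p₂ y)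
      rwa [LinearMap.comp_apply, LinearMap.comp_apply, LinearMap.zero_apply] at h
    rw [LinearMap.comp_apply, LinearMap.comp_apply, hTx, hZi₁]
    conv_lhs => rw [← hsumC y]
    rw [map_add, ← hZi₂ (p₂ y), h0, map_zero, add_zero]
  have hTφ : T * φ₁C = φ₁C * T := by
    refine LinearMap.ext fun x => ?_
    rw [Module.End.mul_apply, Module.End.mul_apply, hTx, hTx, ← hΦi₁, ← Module.End.mul_apply Z ΦC, hZΦ,
      Module.End.mul_apply, hp₁Φ]
  have hTskew : ∀ x y, ψ₁.form.baseChange ℂ (T x) y + ψ₁.form.baseChange ℂ x (T y) = 0 := fun x y => by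
    rw [hψ₁C, hψ₁C, hTx, hTx, hZi₁, hZi₁]
    exact hZskew _ _
  -- §G traces: `tr(φ₁,ℂ T) = tr(Φ_ℂ Z) = tr(Φ_ℂ Y) - (z/c) tr(Φ_ℂ Θ_H) = 0`
  have hN : ψC.Nondegenerate :=
    ⟨fun _ hx => ψ.eq_zero_of_forall_form_eq_zero hx, fun _ hy => ψ.eq_zero_of_forall_form_eq_zero' hy⟩
  have htrY : LinearMap.trace ℂ _ Y = 0 := WeilProductCM.trace_eq_zero_of_skew hN hYskew
  have htrΘ : LinearMap.trace ℂ _ Θ = 0 := WeilProductCM.trace_eq_zero_of_skew hN hΘskew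
  have htrΦY : LinearMap.trace ℂ _ (ΦC * Y) = 0 := by
    have h := WeilProductCM.two_mul_mul_trace_restrict_eq hd hΦ2 hμ hYΦ
      (fun x hx => UnitaryTheta.apply_mem_eigenspace_of_commute hYΦ hx)
    rw [hYtr, htrY, mul_zero, mul_zero, zero_add] at h
    exact h.symm
  have htrΦΘ : LinearMap.trace ℂ _ (ΦC * Θ) = 0 := by
    rw [← hΘΦ, hΦC, trace_theta_mul_baseChange_eq_of_sq_eq_neg H rfl heff hΦE hd hΦ2 hμ hΘ, hbal, hbal', sub_self, sub_self,
      mul_zero, sub_zero]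
  have htrΦZ : LinearMap.trace ℂ _ (ΦC * Z) = 0 := by
    rw [hZdef, mul_sub, mul_smul_comm, map_sub, map_smul, htrΦY, htrΦΘ, smul_zero, sub_zero]
  -- block traces
  have htr₁ : LinearMap.trace ℂ _ (φ₁C * T) = LinearMap.trace ℂ _ ((ΦC * Z) ∘ₗ (i₁ ∘ₗ p₁)) := by
    have h : φ₁C * T = p₁ ∘ₗ ((ΦC * Z) ∘ₗ i₁) := by
      refine LinearMap.ext fun x => ?_
      rw [Module.End.mul_apply, hTx, LinearMap.comp_apply, LinearMap.comp_apply, Module.End.mul_apply, hp₁Φ]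
    rw [h, ← LinearMap.trace_comp_comm', LinearMap.comp_assoc]
  have htr₂ : LinearMap.trace ℂ _ ((ΦC * Z) ∘ₗ (i₂ ∘ₗ p₂)) = 0 := by
    have h : p₂ ∘ₗ ((ΦC * Z) ∘ₗ i₂) = 0 := by
      refine LinearMap.ext fun x => ?_
      have h' := LinearMap.congr_fun hZ₂ x
      rw [LinearMap.comp_apply, LinearMap.comp_apply, LinearMap.zero_apply] at h'
      rw [LinearMap.comp_apply, LinearMap.comp_apply, Module.End.mul_apply, hp₂Φ, h', map_zero, LinearMap.zero_apply]
    rw [← LinearMap.comp_assoc, LinearMap.trace_comp_comm', h, map_zero]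
  have hTtr : LinearMap.trace ℂ _ (φ₁C * T) = 0 := by
    have hsplit : ΦC * Z = (ΦC * Z) ∘ₗ (i₁ ∘ₗ p₁) + (ΦC * Z) ∘ₗ (i₂ ∘ₗ p₂) := by
      rw [← LinearMap.comp_add, ← LinearMap.baseChange_comp, ← LinearMap.baseChange_comp, ← LinearMap.baseChange_add, hsum',
        LinearMap.baseChange_id, LinearMap.comp_id]
    have h : LinearMap.trace ℂ _ (ΦC * Z) =
        LinearMap.trace ℂ _ ((ΦC * Z) ∘ₗ (i₁ ∘ₗ p₁)) + LinearMap.trace ℂ _ ((ΦC * Z) ∘ₗ (i₂ ∘ₗ p₂)) := by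
      conv_lhs => rw [hsplit]
      rw [map_add]
    rw [htr₂, add_zero, htrΦZ] at h
    rw [htr₁, ← h]
  -- §H the corner algebra `𝔤₁ = π₁ 𝔥(H) ι₁` is admissible and `Θ₁ ∈ spanC 𝔤₁`
  let r₁ : Module.End ℚ V →ₗ[ℚ] Module.End ℚ V₁ :=
    (LinearMap.llcomp ℚ _ _ _ π₁.toLinearMap).comp (LinearMap.lcomp ℚ _ ι₁.toLinearMap)
  have hr₁ : ∀ X, r₁ X = π₁.toLinearMap ∘ₗ X ∘ₗ ι₁.toLinearMap := fun X => rfl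
  obtain ⟨𝔤₁, h𝔤₁def⟩ : ∃ 𝔤₁ : Submodule ℚ (Module.End ℚ V₁), 𝔤₁ = H.hodgeLie.map r₁ := ⟨_, rfl⟩
  have h𝔤₁ : ∀ X₁ ∈ 𝔤₁, ∃ X ∈ H.hodgeLie, π₁.toLinearMap ∘ₗ X ∘ₗ ι₁.toLinearMap = X₁ := fun X₁ h => by
    rw [h𝔤₁def] at h
    obtain ⟨X, hX, rfl⟩ := Submodule.mem_map.1 h
    exact ⟨X, hX, rfl⟩
  have hmem𝔤₁ : ∀ X ∈ H.hodgeLie, π₁.toLinearMap ∘ₗ X ∘ₗ ι₁.toLinearMap ∈ 𝔤₁ := fun X hX => by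
    rw [h𝔤₁def]
    exact Submodule.mem_map.2 ⟨X, hX, rfl⟩
  have hbr : ∀ X₁ ∈ 𝔤₁, ∀ X₁' ∈ 𝔤₁, X₁ * X₁' - X₁' * X₁ ∈ 𝔤₁ := by
    intro X₁ h X₁' h'
    obtain ⟨X, hX, rfl⟩ := h𝔤₁ X₁ h
    obtain ⟨X', hX', rfl⟩ := h𝔤₁ X₁' h'
    rw [← restrict_mul ι₁ π₁ hπι₁ hX', ← restrict_mul ι₁ π₁ hπι₁ hX, ← LinearMap.comp_sub, ← LinearMap.sub_comp]
    exact hmem𝔤₁ _ (H.commutator_mem_hodgeLie hX hX')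
  have hcomm : ∀ X₁ ∈ 𝔤₁, ∀ a : H₁.endAlg, X₁ * (a : Module.End ℚ V₁) = (a : Module.End ℚ V₁) * X₁ := fun X₁ h a => by
    obtain ⟨X, hX, rfl⟩ := h𝔤₁ X₁ h
    exact commute_of_mem_hodgeLie H₁ (comp_mem_hodgeLie_of_retract ι₁ π₁ hπι₁ hX) a
  have hskew₁ : ∀ X₁ ∈ 𝔤₁, ∀ v w, ψ₁.form (X₁ v) w + ψ₁.form v (X₁ w) = 0 := fun X₁ h v w => by
    obtain ⟨X, hX, rfl⟩ := h𝔤₁ X₁ h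
    exact form_apply_add_eq_zero_of_mem_hodgeLie ψ₁ (comp_mem_hodgeLie_of_retract ι₁ π₁ hπι₁ hX) v w
  have hcornerC : ∀ Z' ∈ H.hodgeLieC, p₁ ∘ₗ Z' ∘ₗ i₁ ∈ spanC 𝔤₁ := by
    intro Z' hZ'
    induction hZ' using Submodule.span_induction with
    | mem Z' h =>
      obtain ⟨X, hX, rfl⟩ := h
      rw [hp₁, hi₁, ← LinearMap.baseChange_comp, ← LinearMap.baseChange_comp]
      exact baseChange_mem_spanC (hmem𝔤₁ X hX)
    | zero => rw [LinearMap.zero_comp, LinearMap.comp_zero]; exact Submodule.zero_mem _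
    | add Z' Z'' _ _ h h' => rw [LinearMap.add_comp, LinearMap.comp_add]; exact Submodule.add_mem _ h h'
    | smul a Z' _ h => rw [LinearMap.smul_comp, LinearMap.comp_smul]; exact Submodule.smul_mem _ a h
  have hΘ𝔤₁ : Θ₁ ∈ spanC 𝔤₁ := by
    have h := hcornerC Θ hΘC
    have hΘ₁eq : p₁ ∘ₗ Θ ∘ₗ i₁ = Θ₁ :=
      LinearMap.ext fun x => by rw [LinearMap.comp_apply, LinearMap.comp_apply, hpΘi₁]
    rwa [hΘ₁eq] at h
  have hU₁ := hLie₁ ψ₁ 𝔤₁ hbr hΘ𝔤₁ hcomm hskew₁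
  -- §I brackets of corners lift: `ι₁ [π₁Xι₁, π₁X′ι₁] π₁ = [X, X′] ∈ 𝔥(H)`
  let ℓ : Module.End ℂ (ℂ ⊗[ℚ] V₁) →ₗ[ℂ] Module.End ℂ (ℂ ⊗[ℚ] V) :=
    (LinearMap.llcomp ℂ _ _ _ i₁).comp (LinearMap.lcomp ℂ _ p₁)
  have hℓ : ∀ D, ℓ D = i₁ ∘ₗ D ∘ₗ p₁ := fun D => rfl
  have hliftQ : ∀ X ∈ H.hodgeLie, ∀ X' ∈ H.hodgeLie,
      ι₁.toLinearMap ∘ₗ ((π₁.toLinearMap ∘ₗ X ∘ₗ ι₁.toLinearMap) * (π₁.toLinearMap ∘ₗ X' ∘ₗ ι₁.toLinearMap) -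
        (π₁.toLinearMap ∘ₗ X' ∘ₗ ι₁.toLinearMap) * (π₁.toLinearMap ∘ₗ X ∘ₗ ι₁.toLinearMap)) ∘ₗ π₁.toLinearMap =
      X * X' - X' * X := by
    intro X hX X' hX'
    have hCmem : X * X' - X' * X ∈ H.hodgeLie := H.commutator_mem_hodgeLie hX hX'
    rw [← restrict_mul ι₁ π₁ hπι₁ hX', ← restrict_mul ι₁ π₁ hπι₁ hX, ← LinearMap.comp_sub, ← LinearMap.sub_comp]
    -- `C = C (ι₁π₁ + ι₂π₂) = ι₁ (π₁ C ι₁) π₁ + ι₂ (π₂ C ι₂) π₂` and `π₂ C ι₂ = 0`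
    have h1 := comp_incl_eq_incl_comp_restrict ι₁ π₁ hπι₁ hCmem
    have h2 := comp_incl_eq_incl_comp_restrict ι₂ π₂ hπι₂ hCmem
    rw [restrict₂_commutator_eq_zero_of_cmCurve ι₂ π₂ hπι₂ rfl heff₂ ψ₂ hφ₂E hd hφ₂ hV₂ hX hX', LinearMap.comp_zero] at h2
    have h1v : ∀ w, (X * X' - X' * X) (ι₁.toLinearMap w) =
        ι₁.toLinearMap (π₁.toLinearMap ((X * X' - X' * X) (ι₁.toLinearMap w))) := fun w => by
      have h := LinearMap.congr_fun h1 w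
      simpa only [LinearMap.comp_apply] using h
    have h2v : ∀ w, (X * X' - X' * X) (ι₂.toLinearMap w) = 0 := fun w => by
      have h := LinearMap.congr_fun h2 w
      simpa only [LinearMap.comp_apply, LinearMap.zero_apply] using h
    refine LinearMap.ext fun v => ?_
    rw [LinearMap.comp_apply, LinearMap.comp_apply, LinearMap.comp_apply, LinearMap.comp_apply, ← h1v]
    conv_rhs => rw [← hsum v]
    rw [map_add, h2v, add_zero]
  have hlift : ∀ A ∈ spanC 𝔤₁, ∀ B ∈ spanC 𝔤₁, ℓ (A * B - B * A) ∈ H.hodgeLieC := by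
    -- the bilinear map `(A, B) ↦ ι₁ [A, B] π₁` sends generators to `𝔥(H)_ℂ`
    let f : Module.End ℂ (ℂ ⊗[ℚ] V₁) →ₗ[ℂ] Module.End ℂ (ℂ ⊗[ℚ] V₁) →ₗ[ℂ] Module.End ℂ (ℂ ⊗[ℚ] V) :=
      LinearMap.mk₂ ℂ (fun A B => ℓ (A * B - B * A))
        (fun A A' B => by rw [add_mul, mul_add, ← map_add]; congr 1; abel)
        (fun a A B => by rw [smul_mul_assoc, mul_smul_comm, ← smul_sub, map_smul])
        (fun A B B' => by rw [mul_add, add_mul, ← map_add]; congr 1; abel)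
        (fun a A B => by rw [mul_smul_comm, smul_mul_assoc, ← smul_sub, map_smul])
    have hf : ∀ A B, f A B = ℓ (A * B - B * A) := fun A B => rfl
    intro A hA B hB
    rw [← hf]
    have hle : Submodule.map₂ f (spanC 𝔤₁) (spanC 𝔤₁) ≤ H.hodgeLieC := by
      change Submodule.map₂ f (Submodule.span ℂ _) (Submodule.span ℂ _) ≤ _
      rw [Submodule.map₂_span_span, Submodule.span_le]
      rintro _ ⟨_, ⟨X₁, hX₁, rfl⟩, _, ⟨X₁', hX₁', rfl⟩, rfl⟩
      obtain ⟨X, hX, rfl⟩ := h𝔤₁ X₁ hX₁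
      obtain ⟨X', hX', rfl⟩ := h𝔤₁ X₁' hX₁'
      change f ((π₁.toLinearMap ∘ₗ X ∘ₗ ι₁.toLinearMap).baseChange ℂ)
        ((π₁.toLinearMap ∘ₗ X' ∘ₗ ι₁.toLinearMap).baseChange ℂ) ∈ H.hodgeLieC
      rw [hf, hℓ, ← LinearMap.baseChange_mul, ← LinearMap.baseChange_mul, ← LinearMap.baseChange_sub, hi₁, hp₁,
        ← LinearMap.baseChange_comp, ← LinearMap.baseChange_comp, hliftQ X hX X' hX']
      exact baseChange_mem_hodgeLieC H (H.commutator_mem_hodgeLie hX hX')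
    exact hle (Submodule.apply_mem_map₂ f hA hB)
  -- §J conclusion: `T ∈ span [𝔲₁, 𝔲₁]` (hSL₁), `𝔲₁ = spanC 𝔤₁` (hLie₁), so `ι₁ T π₁ ∈ 𝔥(H)_ℂ`; `Y = (z/c) Θ_H + ι₁ T π₁`
  have hT := hSL₁ ψ₁ T hTφ hTskew hTtr
  have hℓT : ℓ T ∈ H.hodgeLieC := by
    have hle : Submodule.span ℂ {D : Module.End ℂ (ℂ ⊗[ℚ] V₁) | ∃ A B : Module.End ℂ (ℂ ⊗[ℚ] V₁),
        A * φ₁.baseChange ℂ = φ₁.baseChange ℂ * A ∧ B * φ₁.baseChange ℂ = φ₁.baseChange ℂ * B ∧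
        (∀ x y, ψ₁.form.baseChange ℂ (A x) y + ψ₁.form.baseChange ℂ x (A y) = 0) ∧
        (∀ x y, ψ₁.form.baseChange ℂ (B x) y + ψ₁.form.baseChange ℂ x (B y) = 0) ∧ D = A * B - B * A} ≤
        H.hodgeLieC.comap ℓ := by
      rw [Submodule.span_le]
      rintro D ⟨A, B, hA, hB, hAs, hBs, rfl⟩
      exact hlift A (hU₁ A hA hAs) B (hU₁ B hB hBs)
    exact hle hT
  have hY : Y = lam • Θ + ℓ T := by
    rw [hℓ, ← hZT, hZdef, add_sub_cancel]
  rw [hY]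
  exact Submodule.add_mem _ (Submodule.smul_mem _ _ hΘC) hℓT

end HodgeStructure

end Literature.AlgebraicGeometry.Motives
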